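import Literature.NumberTheory.Transcendental.RoySmallValueEstimatesProjPlaneProofs
import Mathlib.GroupTheory.Perm.Basic
import Mathlib.GroupTheory.OrderOfElement
import Mathlib.Data.Fintype.Perm
import HarnessLib

/-!
# Small value estimates at rational translates (Nguyen–Roy 2016) — proofs: the fixed points of the translations `τᵏ`

Proofs file towards `Literature.NumberTheory.Transcendental.nguyenRoy2016_thm_1` (Nguyen–Roy,
*A small value estimate in dimension two involving translations by rational points*, IJNT 12 (2016)
= arXiv:1412.5163, Theorem 1). Everything here is PROVED; no definitions, no named facts. It
supplies the following step of the proof of **Proposition 14** (§5), for the translations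
`τ` of `ℙ²(ℂ)` of §2 in the tree's form `NguyenRoy.tauP r hs i` (`RoySmallValueEstimatesProjPlaneProofs`):

> If the sets `τⁱ(Z)` (`i ∈ ℤ`) are not all distinct, then there exists a positive integer `k`
> such that `τᵏ(Z) = Z`. As `Z` is a finite set, we may further choose `k` so that `τᵏ` fixes
> each element of `Z`. Then `Z` consists of a single point `(0:1:0)` or `(0:0:1)`, since the
> latter are the only points of `ℙ²(ℂ)` fixed by a power `τᵏ` of `τ` with `k ∈ ℕ*`.

* `eq_of_tauP_eq_self` — **the fixed points of `τᵏ` (`k ≠ 0`) are `(0:1:0)` and `(0:0:1)`**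
  (`r ≠ 0`, `s ≠ 0`, `sᵏ ≠ 1` for `k ≠ 0`): `τ̲ᵏ(x,y,z) = (x, y + krx, sᵏz) = c(x,y,z)` forces
  `x = 0` and then `z = 0` or `y = 0`; conversely both points are fixed (`tauP_e010`, `tauP_e001`).
* `forall_tauP_eq_self_of_image_eq` — **a finite set `S` with `τᵏ(S) = S` is fixed pointwise by
  `τ^{(#S)!·k}`** (`τᵏ` permutes `S`, and a permutation of `S` has order dividing `(#S)!`);
  `tauP_iterate` (`(τᵏ)ⁿ = τ^{nk}`).
* `subset_of_image_tauP_eq` — hence such an `S` (with `k ≠ 0`) is contained in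
  `{(0:1:0), (0:0:1)}`, and `image_tauP_injective` — **if `S` contains any other point, the
  translates `τⁱ(S)`, `i ∈ ℤ`, are pairwise distinct**.
* `rat_cast_zpow_ne_one` — for `s ∈ ℚ`, `s ≠ ±1`: `sᵏ ≠ 1` in `ℂ` (`k ∈ ℤ ∖ {0}`; for `s = 0` and
  `k < 0` this reads `0⁻¹ ≠ 1`), the hypothesis of Theorem 1 in the form used here.

## References

* [NguyenRoy2016] N. A. V. Nguyen, D. Roy, IJNT 12 (2016) 1273–1293 = arXiv:1412.5163, §2 (the
  translations `τ`), §5, proof of Proposition 14 (the paragraph quoted above).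
-/

noncomputable section

open Finset

namespace Literature.NumberTheory.Transcendental

namespace NguyenRoy

variable {r s : ℂ}

/-! ### Iterates -/

/-- `(τᵏ)ⁿ = τ^{nk}` on `ℙ²(ℂ)`. [cite: NguyenRoy2016, §2] -/
theorem tauP_iterate (r : ℂ) (hs : s ≠ 0) (k : ℤ) (n : ℕ) (a : PPt) :
    (tauP r hs k)^[n] a = tauP r hs (n * k) a := by
  induction n generalizing a with
  | zero => simp [tauP_zero]
  | succ n ih =>
    rw [Function.iterate_succ_apply', ih, tauP_tauP, show ((n + 1 : ℕ) : ℤ) * k = k + n * k by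
      push_cast; ring]

/-- `τᵏ` is injective on `ℙ²(ℂ)` (inverse `τ^{−k}`). [folklore] -/
theorem tauP_injective (r : ℂ) (hs : s ≠ 0) (k : ℤ) : Function.Injective (tauP r hs k) := by
  intro a b h
  have := congrArg (tauP r hs (-k)) h
  rwa [tauP_tauP, tauP_tauP, neg_add_cancel, tauP_zero, tauP_zero] at this

/-! ### The fixed points of `τᵏ` -/

/-- `(0, 1, 0) ≠ 0`. [folklore] -/
theorem e010_ne_zero : (![0, 1, 0] : V3) ≠ 0 := fun h => by simpa using congrFun h 1

/-- `(0, 0, 1) ≠ 0`. [folklore] -/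
theorem e001_ne_zero : (![0, 0, 1] : V3) ≠ 0 := fun h => by simpa using congrFun h 2

/-- `(0:1:0)` is fixed by every `τⁱ`. [cite: NguyenRoy2016, proof of Proposition 14] -/
theorem tauP_e010 (r : ℂ) (hs : s ≠ 0) (i : ℤ) :
    tauP r hs i (Projectivization.mk ℂ ![0, 1, 0] e010_ne_zero) =
      Projectivization.mk ℂ ![0, 1, 0] e010_ne_zero := by
  rw [tauP_mk]
  congr 1
  rw [tauMat_zpow r hs, tauMatPow_mulVec]
  ext a
  fin_cases a <;> simp

/-- `(0:0:1)` is fixed by every `τⁱ`. [cite: NguyenRoy2016, proof of Proposition 14] -/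
theorem tauP_e001 (r : ℂ) (hs : s ≠ 0) (i : ℤ) :
    tauP r hs i (Projectivization.mk ℂ ![0, 0, 1] e001_ne_zero) =
      Projectivization.mk ℂ ![0, 0, 1] e001_ne_zero := by
  rw [tauP_mk, Projectivization.mk_eq_mk_iff]
  refine ⟨Units.mk0 (s ^ i) (zpow_ne_zero i hs), ?_⟩
  rw [tauMat_zpow r hs, tauMatPow_mulVec, Units.smul_def, Units.val_mk0]
  ext a
  fin_cases a <;> simp

/-- **The only points of `ℙ²(ℂ)` fixed by a power `τᵏ` (`k ≠ 0`) are `(0:1:0)` and `(0:0:1)`**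
(`r ≠ 0`, `s ≠ 0` with `sᵏ ≠ 1` for `k ≠ 0`, e.g. `s ∈ ℚ ∖ {0, ±1}`).
[cite: NguyenRoy2016, proof of Proposition 14] -/
theorem eq_of_tauP_eq_self (hr : r ≠ 0) (hs : s ≠ 0) (hs1 : ∀ k : ℤ, k ≠ 0 → s ^ k ≠ 1)
    {k : ℤ} (hk : k ≠ 0) {a : PPt} (h : tauP r hs k a = a) :
    a = Projectivization.mk ℂ ![0, 1, 0] e010_ne_zero ∨
      a = Projectivization.mk ℂ ![0, 0, 1] e001_ne_zero := by
  induction a using Projectivization.ind with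
  | h v hv =>
    rw [tauP_mk, Projectivization.mk_eq_mk_iff] at h
    obtain ⟨c, hc⟩ := h
    rw [tauMat_zpow r hs, tauMatPow_mulVec] at hc
    have hc' : ∀ a, (c : ℂ) * v a = (![v 0, ↑k * r * v 0 + v 1, s ^ k * v 2] : V3) a := by
      intro a
      have := congrFun hc a
      rw [Pi.smul_apply, Units.smul_def, smul_eq_mul] at this
      exact this
    have h0 : (c : ℂ) * v 0 = v 0 := hc' 0
    have h1 : (c : ℂ) * v 1 = k * r * v 0 + v 1 := hc' 1
    have h2 : (c : ℂ) * v 2 = s ^ k * v 2 := hc' 2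
    -- `v 0 = 0`
    have hv0 : v 0 = 0 := by
      by_contra hv0
      have hc1 : (c : ℂ) = 1 := by
        have := mul_right_cancel₀ hv0 (h0.trans (one_mul (v 0)).symm)
        exact this
      rw [hc1, one_mul] at h1
      have : (k : ℂ) * r * v 0 = 0 := by linear_combination -h1
      simp only [mul_eq_zero, Int.cast_eq_zero] at this
      rcases this with (h | h) | h
      · exact hk h
      · exact hr h
      · exact hv0 h
    by_cases hv1 : v 1 = 0
    · -- `v = v₂ (0,0,1)`
      right
      have hv2 : v 2 ≠ 0 := by
        intro hv2
        apply hv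
        ext a
        fin_cases a <;> simp [hv0, hv1, hv2]
      rw [Projectivization.mk_eq_mk_iff]
      refine ⟨Units.mk0 (v 2) hv2, ?_⟩
      ext a
      fin_cases a <;> simp [hv0, hv1]
    · -- `c = 1`, then `v 2 = 0`, `v = v₁ (0,1,0)`
      left
      have hc1 : (c : ℂ) = 1 := by
        rw [hv0, mul_zero, zero_add] at h1
        exact mul_right_cancel₀ hv1 (h1.trans (one_mul (v 1)).symm)
      have hv2 : v 2 = 0 := by
        rw [hc1, one_mul] at h2
        by_contra hv2
        have : s ^ k = 1 := (mul_right_cancel₀ hv2 (h2.symm.trans (one_mul (v 2)).symm))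
        exact hs1 k hk this
      rw [Projectivization.mk_eq_mk_iff]
      refine ⟨Units.mk0 (v 1) hv1, ?_⟩
      ext a
      fin_cases a <;> simp [hv0, hv2]

/-! ### Finite invariant sets -/

section Invariant

variable [DecidableEq PPt]

/-- **A finite set `S` with `τᵏ(S) = S` is fixed pointwise by `τ^{(#S)!·k}`** (`τᵏ` permutes `S`;
a permutation of `S` raised to the power `(#S)!` is the identity).
[cite: NguyenRoy2016, proof of Proposition 14 ("we may further choose k so that τᵏ fixes each element of Z")] -/
theorem forall_tauP_eq_self_of_image_eq (r : ℂ) (hs : s ≠ 0) {S : Finset PPt} {k : ℤ}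
    (h : S.image (tauP r hs k) = S) :
    ∀ a ∈ S, tauP r hs ((S.card.factorial : ℕ) * k) a = a := by
  -- `τᵏ` as a permutation of `S`
  have hmem : ∀ a ∈ S, tauP r hs k a ∈ S := fun a ha => by
    rw [← h]
    exact Finset.mem_image_of_mem _ ha
  set σ : ↥S → ↥S := fun a => ⟨tauP r hs k a, hmem a a.2⟩ with hσ
  have hσinj : Function.Injective σ := fun a b hab =>
    Subtype.ext (tauP_injective r hs k (congrArg Subtype.val hab))
  have hσbij : Function.Bijective σ := Finite.injective_iff_bijective.mp hσinj
  set e : Equiv.Perm ↥S := Equiv.ofBijective σ hσbij with he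
  have hiter : ∀ (n : ℕ) (a : ↥S), ((e ^ n) a : PPt) = (tauP r hs k)^[n] a := by
    intro n
    induction n with
    | zero => intro a; simp
    | succ n ih =>
      intro a
      rw [pow_succ', Equiv.Perm.mul_apply, Function.iterate_succ_apply', ← ih]
      rfl
  have hpow : e ^ (S.card.factorial) = 1 := by
    have h1 := pow_card_eq_one (G := Equiv.Perm ↥S) (x := e)
    rwa [Fintype.card_perm, Fintype.card_coe] at h1
  intro a ha
  have := hiter (S.card.factorial) ⟨a, ha⟩
  rw [hpow, Equiv.Perm.one_apply] at this
  rw [← tauP_iterate, ← this]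

/-- **A finite `τᵏ`-invariant set (`k ≠ 0`) consists of fixed points**: it is contained in
`{(0:1:0), (0:0:1)}`. [cite: NguyenRoy2016, proof of Proposition 14] -/
theorem subset_of_image_tauP_eq (hr : r ≠ 0) (hs : s ≠ 0) (hs1 : ∀ k : ℤ, k ≠ 0 → s ^ k ≠ 1)
    {S : Finset PPt} {k : ℤ} (hk : k ≠ 0) (h : S.image (tauP r hs k) = S) :
    ∀ a ∈ S, a = Projectivization.mk ℂ ![0, 1, 0] e010_ne_zero ∨
      a = Projectivization.mk ℂ ![0, 0, 1] e001_ne_zero := by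
  intro a ha
  refine eq_of_tauP_eq_self hr hs hs1 (k := (S.card.factorial : ℕ) * k) ?_
    (forall_tauP_eq_self_of_image_eq r hs h a ha)
  exact mul_ne_zero (Int.natCast_ne_zero.mpr (Nat.factorial_ne_zero _)) hk

/-- **The translates of a finite set containing a non-fixed point are pairwise distinct**: if
`S ∋ a` with `a ≠ (0:1:0), (0:0:1)`, then `i ↦ τⁱ(S)` is injective on `ℤ`.
[cite: NguyenRoy2016, proof of Proposition 14 ("we may assume that Z, τ(Z), …, τ^{T−1}(Z) are distinct")] -/
theorem image_tauP_injective (hr : r ≠ 0) (hs : s ≠ 0) (hs1 : ∀ k : ℤ, k ≠ 0 → s ^ k ≠ 1)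
    {S : Finset PPt} {a : PPt} (ha : a ∈ S)
    (ha1 : a ≠ Projectivization.mk ℂ ![0, 1, 0] e010_ne_zero)
    (ha2 : a ≠ Projectivization.mk ℂ ![0, 0, 1] e001_ne_zero) :
    Function.Injective fun i : ℤ => S.image (tauP r hs i) := by
  intro i j hij
  by_contra hne
  have hk : j - i ≠ 0 := sub_ne_zero.mpr (Ne.symm hne)
  -- `τ^{j−i}(S) = S`
  have hS : S.image (tauP r hs (j - i)) = S := by
    have hij' : S.image (tauP r hs i) = S.image (tauP r hs j) := hij
    have h' := congrArg (fun T : Finset PPt => T.image (tauP r hs (-i))) hij'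
    simp only [Finset.image_image] at h'
    have hl : (tauP r hs (-i)) ∘ (tauP r hs i) = id := by
      funext b; simp [Function.comp, tauP_tauP, tauP_zero]
    have hr' : (tauP r hs (-i)) ∘ (tauP r hs j) = tauP r hs (j - i) := by
      funext b
      simp only [Function.comp, tauP_tauP]
      congr 1
      ring
    rw [hl, hr', Finset.image_id] at h'
    exact h'.symm
  rcases subset_of_image_tauP_eq hr hs hs1 hk hS a ha with h | h
  · exact ha1 h
  · exact ha2 h

end Invariant

/-- For `s ∈ ℚ`, `s ≠ ±1`: `sᵏ ≠ 1` in `ℂ` for every integer `k ≠ 0`. [folklore] -/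
theorem rat_cast_zpow_ne_one {s : ℚ} (hs1 : s ≠ 1) (hs2 : s ≠ -1) {k : ℤ} (hk : k ≠ 0) :
    (s : ℂ) ^ k ≠ 1 := by
  -- natural powers first
  have hnat : ∀ n : ℕ, n ≠ 0 → (s : ℂ) ^ n ≠ 1 := by
    intro n hn h
    have h' : s ^ n = 1 := by exact_mod_cast h
    have habs : |s| ^ n = 1 := by rw [← abs_pow, h', abs_one]
    have h1 : |s| = 1 := (pow_eq_one_iff_of_nonneg (abs_nonneg s) hn).mp habs
    rcases (abs_eq zero_le_one).mp h1 with h | h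
    · exact hs1 h
    · exact hs2 h
  rcases Int.eq_nat_or_neg k with ⟨n, rfl | rfl⟩
  · rw [zpow_natCast]
    exact hnat n (by exact_mod_cast hk)
  · rw [zpow_neg, zpow_natCast, Ne, inv_eq_one]
    exact hnat n (by simpa using hk)

end NguyenRoy

end Literature.NumberTheory.Transcendental
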